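import Mathlib

/-!
# Elementary word length, crux `WordLengthQP` — stub `stub_interpNodes` (moment weights)

Route `ValiantsHypothesis/ElementaryWordLength`, crux item `stmt-ValiantsHypothesis-6623`
(`Summit.ValiantsHypothesis.ValiantsHypothesis.Theses.ElementaryWordLength.WordLengthQP`),
line `Sketch`, stub `stub_interpNodes`: step 2 of the converse transfer (de-bordering by
interpolation).  For `q ≤ D` there are `D + 1` nodes `xᵢ ∈ ℂ` and weights `cᵢ ∈ ℂ` with
`Σᵢ cᵢ xᵢ ^ k = [k = q]` for every `k ≤ D`, so that `coeff_q P = Σᵢ cᵢ P(xᵢ)` for every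
polynomial `P(ε)` of degree `≤ D`.

Proof (Lagrange).  Take the nodes `xᵢ := i` (`i = 0, …, D`, pairwise distinct in characteristic
zero) and the weights `cᵢ := coeff_q Lᵢ`, `Lᵢ` the Lagrange basis polynomial of the nodes at `i`.
For `k ≤ D` the monomial `X ^ k` has degree `< D + 1`, so it equals its own Lagrange interpolant
`Σᵢ xᵢ ^ k • Lᵢ` (`Lagrange.eq_interpolate`); comparing `q`-th coefficients gives
`[q = k] = Σᵢ xᵢ ^ k · cᵢ`.
-/

-- `Summit.ValiantsHypothesis.ValiantsHypothesis.…` is the tree's mandated single-conjunct layout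
-- (Sub = Summit), so the duplicated namespace component is intended.
set_option linter.dupNamespace false

noncomputable section

namespace Summit.ValiantsHypothesis.ValiantsHypothesis.Cruxes.WordLengthQP.EpsOrderLadder

open Polynomial in
/-- **Coefficients of monomials through the Lagrange basis at the nodes `0, …, D`.**  For
`k ≤ D`, the `q`-th coefficient of `X ^ k ∈ ℂ[X]` is `Σᵢ (coeff_q Lᵢ) · i ^ k`, where `Lᵢ` is the
Lagrange basis polynomial at the node `i ∈ {0, …, D}` (because `X ^ k` is its own interpolant,
`deg X ^ k = k < D + 1`). [folklore] -/
theorem interpNodes_coeff_X_pow_eq_sum (D k q : ℕ) (hk : k ≤ D) :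
    ((X : ℂ[X]) ^ k).coeff q =
      ∑ i : Fin (D + 1),
        (Lagrange.basis (Finset.univ : Finset (Fin (D + 1)))
            (fun j : Fin (D + 1) => ((j : ℕ) : ℂ)) i).coeff q * ((i : ℕ) : ℂ) ^ k := by
  have hinj : Set.InjOn (fun j : Fin (D + 1) => ((j : ℕ) : ℂ))
      ↑(Finset.univ : Finset (Fin (D + 1))) :=
    fun i _ j _ h => Fin.ext (Nat.cast_injective h)
  have hdeg : ((X : ℂ[X]) ^ k).degree < (Finset.univ : Finset (Fin (D + 1))).card := by
    rw [Finset.card_univ, Fintype.card_fin, degree_X_pow]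
    exact_mod_cast Nat.lt_succ_of_le hk
  conv_lhs => rw [Lagrange.eq_interpolate hinj hdeg]
  rw [Lagrange.interpolate_apply, finsetSum_coeff]
  exact Finset.sum_congr rfl fun i _ => by rw [coeff_C_mul, eval_pow, eval_X, mul_comm]

/-- **stub_interpNodes** (de-bordering, step 2): moment weights — for `q ≤ D` there are `D + 1`
nodes `xᵢ ∈ ℂ` and weights `cᵢ ∈ ℂ` with `Σᵢ cᵢ xᵢ ^ k = [k = q]` for all `k ≤ D` (the `q`-th
coefficients of the Lagrange basis at the distinct nodes `0, …, D`; equivalently, a row of the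
inverse Vandermonde matrix). [folklore] -/
theorem stub_interpNodes (D q : ℕ) (hq : q ≤ D) :
    ∃ x c : Fin (D + 1) → ℂ, ∀ k ≤ D, (∑ i, c i * x i ^ k) = if k = q then 1 else 0 := by
  refine ⟨fun i => ((i : ℕ) : ℂ),
    fun i => (Lagrange.basis (Finset.univ : Finset (Fin (D + 1)))
      (fun j : Fin (D + 1) => ((j : ℕ) : ℂ)) i).coeff q,
    fun k hk => ?_⟩
  rw [← interpNodes_coeff_X_pow_eq_sum D k q hk, Polynomial.coeff_X_pow]
  rcases eq_or_ne k q with rfl | hne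
  · rw [if_pos rfl]
  · rw [if_neg hne, if_neg hne.symm]

end Summit.ValiantsHypothesis.ValiantsHypothesis.Cruxes.WordLengthQP.EpsOrderLadder

end
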